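import Mathlib.Data.Nat.Log
import Literature.Computability.MetaComplexity.ResLin
import Literature.Computability.MetaComplexity.RevResLin
import Literature.Computability.MetaComplexity.PremiseDagAncestors
import HarnessLib

/-!
# Prover–Delayer games for tree-like Res(⊕) (Itsykson–Sokolov)

The Prover–Delayer game of Pudlák–Impagliazzo (2000) for tree-like resolution, one proof system
up [Itsykson–Sokolov, MFCS 2014 §4 / Ann. Pure Appl. Logic 2020, Lemma 5.6 as cited in
Efremenko–Garlík–Itsykson 2024; Gryaznov–Ovcharov–Riazanov, ACM ToCT 2024, §2.3 and Lemma 1]: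
two players share an unsatisfiable CNF `φ` and a board carrying a linear system over `𝔽₂`, empty
at the start. In each move Prover writes a linear form `f`; Delayer either completes it to an
equation `f = a` of his choice, or answers `*`, EARNS A COIN, and lets Prover choose `a`. The game
ends when the system on the board contradicts a clause of `φ` (every solution of the board
falsifies the clause). **Lemma** (`two_pow_le_length_of_guarantees`): *if Delayer has a strategy
that guarantees him at least `t` coins against every Prover, then every TREE-LIKE Res(⊕)
refutation of `φ` (the tree's `IsResLinRefutation`: resolution rule + semantic weakening; tree-like
= every line is used as a premise at most once) has at least `2^t` lines.*

Formalisation. A (deterministic) Delayer strategy is a function `δ : board → form → Option Bool`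
(`none` = the answer `*`). A board `Φ : List LinLit` (most recent equation first) CONFORMS to `δ`
if each of its equations `f = a` was either starred or answered `a` by `δ` on the board below it;
`coins δ Φ` counts its starred equations. "`δ` guarantees `t` coins" (`Guarantees φ δ t`) says:
every `δ`-conform board contradicting a clause of `φ` carries at least `t` coins — the printed
"against any behaviour of Prover, Delayer earns ≥ t coins before the game ends" (Prover's
behaviour = the forms and the values at starred moves; the game ends at the first contradicting
prefix, and coins only grow along a play).

Proof (Pudlák–Impagliazzo's "take the smaller subtree", Jukna 2012 Lemma 18.4, on the tree's
list refutations via the premise-DAG ancestor sets of `PremiseDagAncestors.lean`): Prover walks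
down the refutation from the empty clause keeping the invariant "the board contradicts the
current line"; at a resolution step on `f` she asks `f` and moves to the premise falsified by the
answer, choosing the premise with the smaller sub-derivation when Delayer says `*`; a weakening
step keeps the invariant for free (semantic weakening); at an initial clause the game is over.
Each coin halves the current sub-derivation, so coins `≤ log₂ |π|`.

NOT here: the converse (a Delayer-optimal characterisation), asymmetric games, the space game;
randomised Delayers (a deterministic strategy is what lower bounds use). Applications:
`ResLinExtensible.lean` (Gryaznov–Ovcharov–Riazanov's extensible formulas, `PHPᵐₙ`).

## References

* D. Itsykson, D. Sokolov, *Lower bounds for splittings by linear combinations*, MFCS 2014, §4;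
  *Resolution over linear equations modulo two*, Ann. Pure Appl. Logic 171 (2020) [ItsyksonSokolov2020].
* S. Gryaznov, S. Ovcharov, A. Riazanov, *Resolution over linear equations: combinatorial games for
  tree-like size and space*, ACM Trans. Comput. Theory 16(3) (2024), §2.3, Lemma 1
  [GryaznovOvcharovRiazanov2024].
* K. Efremenko, M. Garlík, D. Itsykson, STOC 2024, Lemma 5.6 [EfremenkoGarlikItsykson2024].
* S. Jukna, *Boolean Function Complexity*, 2012, Lemma 18.4 (the resolution game) [Jukna2012].
-/

namespace Literature.Computability.MetaComplexity

open _root_.Computability Complexity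

namespace ProverDelayer

/-! ### Boards, strategies, coins -/

/-- The board CONTRADICTS the linear clause `C`: every solution of the linear system `Φ` (a list
of equations `(f, a)` = "`⊕_{i∈f} xᵢ = a`") falsifies `C`. [Gryaznov–Ovcharov–Riazanov 2024, §2.3
("a clause … falsified by every solution of the Prover's system")]
[cite: GryaznovOvcharovRiazanov2024, §2.3] -/
def Contradicts (Φ : List LinLit) (C : LinClause) : Prop :=
  ∀ σ : ℕ → Bool, (∀ e ∈ Φ, LinLit.eval σ e = true) → C.eval σ = false

/-- A (deterministic) DELAYER STRATEGY: given the board and the linear form Prover asks, answer a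
value (`some a`) or `*` (`none`, Delayer earns a coin and Prover chooses the value).
[Gryaznov–Ovcharov–Riazanov 2024, §2.3; Itsykson–Sokolov 2020, §5]
[cite: GryaznovOvcharovRiazanov2024, §2.3] -/
abbrev Strategy : Type := List LinLit → Finset ℕ → Option Bool

/-- The board `Φ` (most recent equation first) CONFORMS to the Delayer strategy `δ`: every
equation `f = a` on it was written on top of a conforming board on which `δ` answered `*` or `a`
to the question `f`. These are exactly the boards that can arise in a play against some Prover.
[Gryaznov–Ovcharov–Riazanov 2024, §2.3] [cite: GryaznovOvcharovRiazanov2024, §2.3] -/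
def Conform (δ : Strategy) : List LinLit → Prop
  | [] => True
  | e :: Φ => Conform δ Φ ∧ (δ Φ e.1 = none ∨ δ Φ e.1 = some e.2)

/-- The number of COINS Delayer has earned on the board `Φ`: its equations answered `*`.
[Gryaznov–Ovcharov–Riazanov 2024, §2.3] [cite: GryaznovOvcharovRiazanov2024, §2.3] -/
def coins (δ : Strategy) : List LinLit → ℕ
  | [] => 0
  | e :: Φ => coins δ Φ + if δ Φ e.1 = none then 1 else 0

/-- **Delayer's strategy `δ` guarantees `t` coins on `φ`**: whenever a `δ`-conform board
contradicts a clause of `φ` (the game is over), Delayer has earned at least `t` coins.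
[Gryaznov–Ovcharov–Riazanov 2024, Lemma 1 ("a strategy guaranteeing a win of at least `k` coins
against any Prover"); Itsykson–Sokolov 2020, Lemma 5.6] [cite: GryaznovOvcharovRiazanov2024, Lemma 1] -/
def Guarantees (φ : CNF ℕ) (δ : Strategy) (t : ℕ) : Prop :=
  ∀ Φ : List LinLit, Conform δ Φ → (∃ c ∈ φ, Contradicts Φ (Clause.toLinClause c)) → t ≤ coins δ Φ

variable {δ : Strategy}

/-- Unfolding `Conform` on a nonempty board. [folklore] -/
@[simp] theorem conform_cons (e : LinLit) (Φ : List LinLit) :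
    Conform δ (e :: Φ) ↔ Conform δ Φ ∧ (δ Φ e.1 = none ∨ δ Φ e.1 = some e.2) := Iff.rfl

/-- The empty board conforms. [folklore] -/
@[simp] theorem conform_nil : Conform δ [] := trivial

/-- Unfolding `coins` on a nonempty board. [folklore] -/
@[simp] theorem coins_cons (e : LinLit) (Φ : List LinLit) :
    coins δ (e :: Φ) = coins δ Φ + if δ Φ e.1 = none then 1 else 0 := rfl

/-- The empty board carries no coins. [folklore] -/
@[simp] theorem coins_nil : coins δ [] = 0 := rfl

/-! ### Semantic helpers -/

/-- A board contradicting a clause contradicts every clause that implies it (semantic weakening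
read backwards). [Itsykson–Sokolov 2020, §2] [cite: ItsyksonSokolov2020, §2] -/
theorem Contradicts.of_imp {Φ : List LinLit} {C D : LinClause} (h : Contradicts Φ D)
    (himp : ∀ σ : ℕ → Bool, C.eval σ = true → D.eval σ = true) : Contradicts Φ C := by
  intro σ hσ
  have hD := h σ hσ
  cases hC : C.eval σ
  · rfl
  · rw [himp σ hC] at hD; exact absurd hD (by simp)

/-- After writing `f = a`, a board contradicting `C ∪ D` contradicts the premise `D ∨ (f = ¬a)`
of a resolution step on `f`. [Itsykson–Sokolov 2020, §2 (the resolution rule)] [cite: ItsyksonSokolov2020, §2] -/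
theorem contradicts_insert_of_cons {Φ : List LinLit} {C D : LinClause} (h : Contradicts Φ (C ∪ D))
    (f : Finset ℕ) (a : Bool) {E : LinClause} (hE : E = C ∨ E = D) :
    Contradicts ((f, a) :: Φ) (insert (f, !a) E) := by
  intro σ hσ
  have hf : LinLit.eval σ (f, a) = true := hσ _ (List.mem_cons_self)
  have hΦ : ∀ e ∈ Φ, LinLit.eval σ e = true := fun e he => hσ e (List.mem_cons_of_mem _ he)
  have hCD := h σ hΦ
  rw [LinClause.eval_union] at hCD
  have hna : LinLit.eval σ (f, !a) = false := by
    have h' := LinLit.eval_true_eq_not σ f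
    cases a
    · simp only [Bool.not_false]
      rw [h', hf]; rfl
    · simp only [Bool.not_true]
      rw [h'] at hf
      revert hf; cases LinLit.eval σ (f, false) <;> simp
  rw [LinClause.eval_insert, hna, Bool.false_or]
  revert hCD
  rcases hE with rfl | rfl <;> cases E.eval σ <;> simp

/-! ### The premise DAG of a Res(⊕) derivation -/

/-- The premise DAG of a Res(⊕) derivation is well-formed (premises come earlier).
[Itsykson–Sokolov 2020, §2] [cite: ItsyksonSokolov2020, §2] -/
theorem isPremiseDag_of_isResLinDerivation {φ : CNF ℕ} {π : List ResLinLine}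
    (hπ : IsResLinDerivation φ π) : IsPremiseDag (π.map ResLinLine.premises) := by
  intro b hb a ha
  rw [List.length_map] at hb
  rw [List.getElem_map] at ha
  have hv := hπ b hb
  have hlen : (π.take b).length = b := by simp [hb.le]
  unfold IsValidResLinLine at hv
  rcases hrule : (π[b]'hb).rule with _ | ⟨i, j, f⟩ | ⟨i⟩
  · simp [ResLinLine.premises, hrule, ResLinRule.premises] at ha
  · rw [hrule] at hv
    obtain ⟨hi, hj, -⟩ := hv
    rw [hlen] at hi hj
    simp only [ResLinLine.premises, hrule, ResLinRule.premises, List.mem_cons, List.not_mem_nil,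
      or_false] at ha
    rcases ha with rfl | rfl <;> assumption
  · rw [hrule] at hv
    obtain ⟨hi, -⟩ := hv
    rw [hlen] at hi
    simp only [ResLinLine.premises, hrule, ResLinRule.premises, List.mem_cons, List.not_mem_nil,
      or_false] at ha
    subst ha
    exact hi

/-- Tree-likeness of a derivation (every line used as a premise at most once, with multiplicity)
is tree-likeness of its premise DAG. [folklore] -/
theorem isTreeLikeDag_of_treeLike {π : List ResLinLine}
    (htree : ∀ i : ℕ, (π.map fun l => l.premises.count i).sum ≤ 1) :
    IsTreeLikeDag (π.map ResLinLine.premises) := by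
  intro i
  rw [List.map_map]
  exact htree i

/-! ### The lemma: `t` guaranteed coins force `2^t` lines in every tree-like refutation -/

section Lemma

variable {φ : CNF ℕ} {π : List ResLinLine}

/-- **Prover's strategy read off a tree-like refutation** (the inductive core): if a `δ`-conform
board `Φ` contradicts line `k` of the tree-like derivation `π`, Prover can continue the play from
`Φ` to the end of the game conceding at most `log₂ |sub-derivation of k|` further coins — ask the
resolved form, move to the premise falsified by the answer, and to the premise with the smaller
sub-derivation when Delayer answers `*`. [Gryaznov–Ovcharov–Riazanov 2024, Lemma 1 (proof);
Jukna 2012, Lemma 18.4 (proof)] [cite: GryaznovOvcharovRiazanov2024, Lemma 1] -/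
theorem exists_conform_contradicts_of_line (hπ : IsResLinDerivation φ π)
    (htree : ∀ i : ℕ, (π.map fun l => l.premises.count i).sum ≤ 1) (δ : Strategy) :
    ∀ (k : ℕ) (hk : k < π.length) (Φ : List LinLit), Conform δ Φ →
      Contradicts Φ (π[k]'hk).clause →
      ∃ Φ' : List LinLit, Conform δ Φ' ∧ (∃ c ∈ φ, Contradicts Φ' (Clause.toLinClause c)) ∧
        coins δ Φ' ≤ coins δ Φ + Nat.log 2 (dagAncestors (π.map ResLinLine.premises) k).card := by
  set prem := π.map ResLinLine.premises with hprem_def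
  have hprem : IsPremiseDag prem := isPremiseDag_of_isResLinDerivation hπ
  have htree' : IsTreeLikeDag prem := isTreeLikeDag_of_treeLike htree
  have hpremk : ∀ (k : ℕ) (hk : k < π.length), ∃ hk' : k < prem.length,
      prem[k]'hk' = (π[k]'hk).premises := fun k hk =>
    ⟨by rw [hprem_def, List.length_map]; exact hk, by rw [List.getElem_map]⟩
  intro k
  induction k using Nat.strong_induction_on with
  | _ k IH =>
  intro hk Φ hconf hcontra
  have hv := hπ k hk
  have hlen : (π.take k).length = k := by simp [hk.le]
  unfold IsValidResLinLine at hv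
  rcases hrule : (π[k]'hk).rule with _ | ⟨i, j, f⟩ | ⟨i⟩
  · -- an initial clause: the game is over
    rw [hrule] at hv
    obtain ⟨c, hc, hcl⟩ := hv
    exact ⟨Φ, hconf, ⟨c, hc, hcl ▸ hcontra⟩, Nat.le_add_right _ _⟩
  · -- a resolution step on `f` from lines `i` (containing `f = 0`) and `j` (containing `f = 1`)
    rw [hrule] at hv
    obtain ⟨hi, hj, C, D, hCi, hDj, hcl⟩ := hv
    rw [hlen] at hi hj
    have hik : i < π.length := hi.trans hk
    have hjk : j < π.length := hj.trans hk
    have hgi : (π.take k)[i]'(by rw [hlen]; exact hi) = π[i]'hik := List.getElem_take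
    have hgj : (π.take k)[j]'(by rw [hlen]; exact hj) = π[j]'hjk := List.getElem_take
    rw [hgi] at hCi
    rw [hgj] at hDj
    obtain ⟨hk', hpk⟩ := hpremk k hk
    have hpair : prem[k]'hk' = [i, j] := by
      rw [hpk]; simp [ResLinLine.premises, hrule, ResLinRule.premises]
    have hci : DagConsumes prem i k := ⟨hk', by rw [hpair]; simp⟩
    have hcj : DagConsumes prem j k := ⟨hk', by rw [hpair]; simp⟩
    have hij : i ≠ j := ne_of_isTreeLikeDag_pair htree' hk' hpair
    rw [hcl] at hcontra
    -- the two possible moves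
    have moveI : ∀ Φ₁ : List LinLit, Φ₁ = (f, true) :: Φ → Conform δ Φ₁ →
        ∃ Φ', Conform δ Φ' ∧ (∃ c ∈ φ, Contradicts Φ' (Clause.toLinClause c)) ∧
          coins δ Φ' ≤ coins δ Φ₁ + Nat.log 2 (dagAncestors prem i).card := by
      intro Φ₁ hΦ₁ hconf₁
      refine IH i hi hik Φ₁ hconf₁ ?_
      rw [hCi, hΦ₁]
      exact contradicts_insert_of_cons hcontra f true (Or.inl rfl)
    have moveJ : ∀ Φ₁ : List LinLit, Φ₁ = (f, false) :: Φ → Conform δ Φ₁ →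
        ∃ Φ', Conform δ Φ' ∧ (∃ c ∈ φ, Contradicts Φ' (Clause.toLinClause c)) ∧
          coins δ Φ' ≤ coins δ Φ₁ + Nat.log 2 (dagAncestors prem j).card := by
      intro Φ₁ hΦ₁ hconf₁
      refine IH j hj hjk Φ₁ hconf₁ ?_
      rw [hDj, hΦ₁]
      exact contradicts_insert_of_cons hcontra f false (Or.inr rfl)
    have hlogi : Nat.log 2 (dagAncestors prem i).card ≤ Nat.log 2 (dagAncestors prem k).card :=
      Nat.log_mono_right (card_dagAncestors_le_of_dagConsumes hprem hci)
    have hlogj : Nat.log 2 (dagAncestors prem j).card ≤ Nat.log 2 (dagAncestors prem k).card :=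
      Nat.log_mono_right (card_dagAncestors_le_of_dagConsumes hprem hcj)
    rcases hδ : δ Φ f with _ | a
    · -- Delayer answers `*`: Prover takes the premise with the smaller sub-derivation
      have hsmall := two_mul_min_card_dagAncestors_lt hprem htree' hci hcj hij
      by_cases hle : (dagAncestors prem i).card ≤ (dagAncestors prem j).card
      · rw [min_eq_left hle] at hsmall
        have hconf₁ : Conform δ ((f, true) :: Φ) := ⟨hconf, Or.inl hδ⟩
        obtain ⟨Φ', h1, h2, h3⟩ := moveI _ rfl hconf₁
        refine ⟨Φ', h1, h2, ?_⟩
        have hlog : Nat.log 2 (dagAncestors prem i).card + 1 ≤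
            Nat.log 2 (dagAncestors prem k).card := by
          rw [← Nat.log_mul_base (by norm_num) (card_dagAncestors_pos i).ne']
          exact Nat.log_mono_right (by omega)
        simp only [coins_cons, hδ, if_true] at h3
        omega
      · push Not at hle
        rw [min_eq_right hle.le] at hsmall
        have hconf₁ : Conform δ ((f, false) :: Φ) := ⟨hconf, Or.inl hδ⟩
        obtain ⟨Φ', h1, h2, h3⟩ := moveJ _ rfl hconf₁
        refine ⟨Φ', h1, h2, ?_⟩
        have hlog : Nat.log 2 (dagAncestors prem j).card + 1 ≤
            Nat.log 2 (dagAncestors prem k).card := by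
          rw [← Nat.log_mul_base (by norm_num) (card_dagAncestors_pos j).ne']
          exact Nat.log_mono_right (by omega)
        simp only [coins_cons, hδ, if_true] at h3
        omega
    · -- Delayer answers `a`: Prover moves to the premise falsified by `f = a`
      cases a
      · have hconf₁ : Conform δ ((f, false) :: Φ) := ⟨hconf, Or.inr hδ⟩
        obtain ⟨Φ', h1, h2, h3⟩ := moveJ _ rfl hconf₁
        refine ⟨Φ', h1, h2, ?_⟩
        simp only [coins_cons, hδ] at h3
        simp at h3
        omega
      · have hconf₁ : Conform δ ((f, true) :: Φ) := ⟨hconf, Or.inr hδ⟩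
        obtain ⟨Φ', h1, h2, h3⟩ := moveI _ rfl hconf₁
        refine ⟨Φ', h1, h2, ?_⟩
        simp only [coins_cons, hδ] at h3
        simp at h3
        omega
  · -- a semantic weakening of line `i`: the board contradicts line `i` as well
    rw [hrule] at hv
    obtain ⟨hi, himp⟩ := hv
    rw [hlen] at hi
    have hik : i < π.length := hi.trans hk
    have hgi : (π.take k)[i]'(by rw [hlen]; exact hi) = π[i]'hik := List.getElem_take
    rw [hgi] at himp
    obtain ⟨hk', hpk⟩ := hpremk k hk
    have hci : DagConsumes prem i k :=
      ⟨hk', by rw [hpk]; simp [ResLinLine.premises, hrule, ResLinRule.premises]⟩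
    obtain ⟨Φ', h1, h2, h3⟩ := IH i hi hik Φ hconf (hcontra.of_imp himp)
    refine ⟨Φ', h1, h2, h3.trans ?_⟩
    exact Nat.add_le_add_left
      (Nat.log_mono_right (card_dagAncestors_le_of_dagConsumes hprem hci)) _

/-- **The Prover–Delayer lemma for tree-like Res(⊕)** [Itsykson–Sokolov 2014/2020 (Lemma 5.6 in the
numbering cited by Efremenko–Garlík–Itsykson 2024); Gryaznov–Ovcharov–Riazanov 2024, Lemma 1]: if
Delayer has a strategy guaranteeing at least `t` coins on `φ`, then every TREE-LIKE Res(⊕)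
refutation of `φ` (resolution rule and semantic weakening; every line used as a premise at most
once) has at least `2^t` lines. [cite: GryaznovOvcharovRiazanov2024, Lemma 1] -/
theorem two_pow_le_length_of_guarantees {δ : Strategy} {t : ℕ} (hδ : Guarantees φ δ t)
    (hπ : IsResLinRefutation φ π) (htree : ∀ i : ℕ, (π.map fun l => l.premises.count i).sum ≤ 1) :
    2 ^ t ≤ π.length := by
  obtain ⟨hder, l, hl, hempty⟩ := hπ
  obtain ⟨k, hk, rfl⟩ := List.getElem_of_mem hl
  have hcontra : Contradicts [] (π[k]'hk).clause := by
    intro σ _; rw [hempty]; exact LinClause.eval_empty σ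
  obtain ⟨Φ', hconf, hend, hcoins⟩ :=
    exists_conform_contradicts_of_line hder htree δ k hk [] conform_nil hcontra
  have ht : t ≤ Nat.log 2 (dagAncestors (π.map ResLinLine.premises) k).card := by
    have := hδ Φ' hconf hend
    simp only [coins_nil, zero_add] at hcoins
    exact this.trans hcoins
  have hcard : (dagAncestors (π.map ResLinLine.premises) k).card ≤ π.length :=
    (card_dagAncestors_le k).trans hk
  have hpos : π.length ≠ 0 := by omega
  calc 2 ^ t ≤ 2 ^ Nat.log 2 π.length :=
        Nat.pow_le_pow_right (by norm_num) (ht.trans (Nat.log_mono_right hcard))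
    _ ≤ π.length := Nat.pow_log_le_self 2 hpos

/-- The same in `ℕ∞` form for the record: a strategy guaranteeing `t` coins bounds the size of
every tree-like refutation by `2^t` from below (restated with the exponent on the left for use
with `minResLinRefutationSize`-style infima over tree-like refutations). [folklore] -/
theorem le_length_of_guarantees_of_le {δ : Strategy} {t s : ℕ} (hδ : Guarantees φ δ t)
    (hs : s ≤ 2 ^ t) (hπ : IsResLinRefutation φ π)
    (htree : ∀ i : ℕ, (π.map fun l => l.premises.count i).sum ≤ 1) : s ≤ π.length :=
  hs.trans (two_pow_le_length_of_guarantees hδ hπ htree)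

end Lemma

end ProverDelayer

end Literature.Computability.MetaComplexity
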